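import Summits.Ventures.CertifiedManyBodySolver.Downfold.EmeryFermiFillingGrid24
import HarnessLib

/-!
# The sub-box rule of `EmeryFermiFillingGrid24`, VERSION B: the cap `2·t_pp′·ε ≤ t_pd²` relaxed to the natural
# domain `t_pp′·ε < t_pd²` (`fsD > 0`, `t′/t > −½`)

Venture CertifiedManyBodySolver, cell `pub/hubbard-downfold` (stage S1), seat hubbard-downfold-mod-4 (technique
B); namespace `Summit.Ventures.CertifiedManyBodySolver.Downfold.Emery`. Everything here is PROVED. WHAT THIS IS
NOT: a statement about any material; no number lives here.

`EmeryFermiSurfaceRatioWindow.fsRatio_corner_bounds` / `EmeryFermiFillingGrid24.fsRatio_window_of_checks` carry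
the side condition `2c₂ε ≤ a₁²` (twice the across-Cu O–O hopping times the Fermi energy below `t_pd²`). The
factor 2 is slack: the monotonicity lemmas they call (`fsRatio_anti_c`: `(c₁ + c₂)ε ≤ 2t_pd²`;
`fsRatio_mono_Delta`: `cε ≤ t_pd²`; positivity of `fsD = (Δ + ε)(t_pd² − cε)`) only need `c₂ε < a₁²`. For the
boxes of record the slack is harmless (`2·0.2·2.6 ≈ 1 < t_pd² ≈ 1.3–2.3`), but for the CO-SHIFTED boxes of the
axial census (`EmeryAxialConductionBand`: `t_pp′ ↦ t_pp′ + a`, `a` up to ≈ 0.5 eV) it halves the reach. Here: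

* `fsRatio_corner_boundsB` — the corner bounds under `c₂ε < a₁²`;
* `subBoxCheckB`, `fsRatio_window_of_checksB` — the sub-box rule with that check (everything else verbatim).

Sources: [HybertsenSchluterChristensen1989, Eq. (1)]; [AndersenEtAl1995, §6].
-/

noncomputable section

namespace Summit.Ventures.CertifiedManyBodySolver.Downfold.Emery

open Real Set

/-! ## Corner bounds on the natural domain -/

/-- **CORNER BOUNDS, version B**: as `fsRatio_corner_bounds` with the cap relaxed to `c₂·ε < a₁²`.
[folklore] -/
theorem fsRatio_corner_boundsB {Δ₁ Δ₂ a₁ a₂ b₁ b₂ c₁ c₂ Δ tpd tpp c ε : ℝ}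
    (ha₁ : 0 < a₁) (hc₁ : 0 ≤ c₁) (hcb : c₂ < b₁) (hε : 0 ≤ ε) (hΔε : 0 < Δ₁ + ε)
    (hcap : c₂ * ε < a₁ ^ 2)
    (hΔ : Δ ∈ Set.Icc Δ₁ Δ₂) (ha : tpd ∈ Set.Icc a₁ a₂) (hb : tpp ∈ Set.Icc b₁ b₂)
    (hc : c ∈ Set.Icc c₁ c₂) :
    fsRatio Δ₁ a₁ b₂ c₂ ε ≤ fsRatio Δ tpd tpp c ε ∧ fsRatio Δ tpd tpp c ε ≤ fsRatio Δ₂ a₂ b₁ c₁ ε := by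
  obtain ⟨hΔlo, hΔhi⟩ := hΔ
  obtain ⟨halo, hahi⟩ := ha
  obtain ⟨hblo, hbhi⟩ := hb
  obtain ⟨hclo, hchi⟩ := hc
  have hc0 : 0 ≤ c := hc₁.trans hclo
  have hc₂0 : 0 ≤ c₂ := hc0.trans hchi
  have htpd : 0 < tpd := lt_of_lt_of_le ha₁ halo
  have ha₂ : 0 < a₂ := lt_of_lt_of_le htpd hahi
  -- positivity of the two weights everywhere on the box
  have hsq₁ : a₁ ^ 2 ≤ tpd ^ 2 := pow_le_pow_left₀ ha₁.le halo 2
  have hsq₂ : tpd ^ 2 ≤ a₂ ^ 2 := pow_le_pow_left₀ htpd.le hahi 2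
  have dpos : ∀ {Δ' T' c' : ℝ}, Δ₁ ≤ Δ' → a₁ ≤ T' → 0 ≤ c' → c' ≤ c₂ → 0 < fsD Δ' T' c' ε := by
    intro Δ' T' c' h1 h2 h3 h4
    unfold fsD
    have hT : a₁ ^ 2 ≤ T' ^ 2 := pow_le_pow_left₀ ha₁.le h2 2
    have : 0 < T' ^ 2 - c' * ε := by nlinarith [mul_le_mul_of_nonneg_right h4 hε]
    exact mul_pos (by linarith) this
  have npos : ∀ {T' b' c' : ℝ}, a₁ ≤ T' → b₁ ≤ b' → 0 ≤ c' → c' ≤ c₂ → 0 < fsN T' b' c' ε := by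
    intro T' b' c' h1 h2 h3 h4
    rw [fsN_eq_mul]
    have hT : a₁ ^ 2 ≤ T' ^ 2 := pow_le_pow_left₀ ha₁.le h1 2
    have hbc : 0 ≤ b' - c' := by linarith
    exact mul_pos (by linarith) (by nlinarith [mul_nonneg hε hbc])
  constructor
  · calc fsRatio Δ₁ a₁ b₂ c₂ ε ≤ fsRatio Δ₁ a₁ tpp c₂ ε :=
          fsRatio_anti_tpp hbhi (hblo.trans' (hcb.le.trans' hc₂0) |> fun _ => by linarith) hε
            (dpos le_rfl le_rfl hc₂0 le_rfl) (npos le_rfl hblo hc₂0 le_rfl)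
      _ ≤ fsRatio Δ₁ a₁ tpp c ε :=
          fsRatio_anti_c hchi hΔε.le hε (by nlinarith) (dpos le_rfl le_rfl hc₂0 le_rfl)
            (npos le_rfl hblo hc0 hchi)
      _ ≤ fsRatio Δ₁ tpd tpp c ε :=
          fsRatio_mono_tpd halo ha₁.le hΔε.le hε (dpos le_rfl le_rfl hc0 hchi) (dpos le_rfl halo hc0 hchi)
            (npos le_rfl hblo hc0 hchi) (npos halo hblo hc0 hchi)
      _ ≤ fsRatio Δ tpd tpp c ε :=
          fsRatio_mono_Delta hΔlo (by nlinarith [mul_le_mul_of_nonneg_right hchi hε])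
            (dpos le_rfl halo hc0 hchi) (npos halo hblo hc0 hchi)
  · calc fsRatio Δ tpd tpp c ε ≤ fsRatio Δ₂ tpd tpp c ε :=
          fsRatio_mono_Delta hΔhi (by nlinarith [mul_le_mul_of_nonneg_right hchi hε])
            (dpos hΔlo halo hc0 hchi) (npos halo hblo hc0 hchi)
      _ ≤ fsRatio Δ₂ a₂ tpp c ε :=
          fsRatio_mono_tpd hahi htpd.le (by linarith) hε (dpos (hΔlo.trans hΔhi) halo hc0 hchi)
            (dpos (hΔlo.trans hΔhi) (halo.trans hahi) hc0 hchi) (npos halo hblo hc0 hchi)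
            (npos (halo.trans hahi) hblo hc0 hchi)
      _ ≤ fsRatio Δ₂ a₂ tpp c₁ ε :=
          fsRatio_anti_c hclo (by linarith) hε (by nlinarith)
            (dpos (hΔlo.trans hΔhi) (halo.trans hahi) hc0 hchi)
            (npos (halo.trans hahi) hblo hc₁ (hclo.trans hchi))
      _ ≤ fsRatio Δ₂ a₂ b₁ c₁ ε :=
          fsRatio_anti_tpp hblo (by linarith) hε (dpos (hΔlo.trans hΔhi) (halo.trans hahi) hc₁ (hclo.trans hchi))
            (npos (halo.trans hahi) le_rfl hc₁ (hclo.trans hchi))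

/-! ## The sub-box rule, version B -/

/-- Rational side conditions of a sub-box certificate, VERSION B: identical to `subBoxCheck` except that the cap
`2c₂e₂ ≤ a₁²` is replaced by the natural domain condition `c₂e₂ < a₁²` (`fsD > 0` on the sub-box × bracket, i.e.
`t′/t > −½`). [folklore] -/
def subBoxCheckB (Δ₁ Δ₂ a₁ a₂ b₁ b₂ c₁ c₂ e₁ e₂ Ahi Dlo Nlo Alo Dhi Nhi : ℚ) : Bool :=
  decide (0 < a₁) && decide (a₁ ≤ a₂) && decide (0 ≤ c₁) && decide (c₁ ≤ c₂) && decide (c₂ < b₁) &&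
  decide (b₁ ≤ b₂) && decide (0 < Δ₁) && decide (Δ₁ ≤ Δ₂) && decide (0 ≤ e₁) && decide (e₁ ≤ e₂) &&
  decide (c₂ * e₂ < a₁ ^ 2) &&
  decide (e₁ * (Δ₂ + e₁) ^ 2 ≤ Ahi) && decide (Dlo ≤ (Δ₁ + e₁) * (a₁ ^ 2 - c₂ * e₁)) &&
  decide (Nlo ≤ (c₁ + b₁) * (2 * a₁ ^ 2 + e₁ * (b₁ - c₂))) && decide (0 ≤ Dlo) && decide (0 ≤ Nlo) &&
  decide (Alo ≤ e₂ * (Δ₁ + e₂) ^ 2) && decide ((Δ₂ + e₂) * (a₂ ^ 2 - c₁ * e₂) ≤ Dhi) &&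
  decide ((c₂ + b₂) * (2 * a₂ ^ 2 + e₂ * (b₂ - c₁)) ≤ Nhi) && decide (0 ≤ Dhi) && decide (0 ≤ Nhi)

/-- **THE SUB-BOX RULE, version B** (cap `c₂e₂ < a₁²`; otherwise verbatim `fsRatio_window_of_checks`). [folklore] -/
theorem fsRatio_window_of_checksB {K : ℕ} (hK : 0 < K) {xl xh : ℕ → ℚ} (hG : GridEncl K xl xh)
    {Δ₁ Δ₂ a₁ a₂ b₁ b₂ c₁ c₂ e₁ e₂ Ahi Dlo Nlo Alo Dhi Nhi lo hi ν₁ ν₂ : ℚ} {m : ℕ}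
    (hchk : subBoxCheckB Δ₁ Δ₂ a₁ a₂ b₁ b₂ c₁ c₂ e₁ e₂ Ahi Dlo Nlo Alo Dhi Nhi = true)
    (hOut : ((outerFlagged K xl Ahi Dlo Nlo).card : ℚ) / (K : ℚ) ^ 2 < ν₁)
    (hIn : ν₂ < ((innerFlagged K xh e₂ Alo Dhi Nhi Δ₁ (a₂ ^ 2) (b₂ ^ 2)).card : ℚ) / (K : ℚ) ^ 2)
    (hRlo : ratioCheck Δ₁ a₁ b₂ c₂ e₁ e₂ m lo 0 = true)
    (hRhi : ratioCheck Δ₂ a₂ b₁ c₁ e₁ e₂ m (-1) hi = true)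
    {Δ tpd tpp c ε : ℝ} (hΔ : Δ ∈ Set.Icc (Δ₁ : ℝ) Δ₂) (ha : tpd ∈ Set.Icc (a₁ : ℝ) a₂)
    (hb : tpp ∈ Set.Icc (b₁ : ℝ) b₂) (hc : c ∈ Set.Icc (c₁ : ℝ) c₂)
    (hν : abFilling Δ tpd tpp c ε ∈ Set.Icc (ν₁ : ℝ) ν₂) :
    ε ∈ Set.Icc (e₁ : ℝ) e₂ ∧ fsRatio Δ tpd tpp c ε ∈ Set.Icc (lo : ℝ) hi := by
  simp only [subBoxCheckB, Bool.and_eq_true, decide_eq_true_eq] at hchk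
  obtain ⟨⟨⟨⟨⟨⟨⟨⟨⟨⟨⟨⟨⟨⟨⟨⟨⟨⟨⟨⟨qa₁, qa⟩, qc₁⟩, qc⟩, qcb⟩, qb⟩, qΔ₁⟩, qΔ⟩, qe₁⟩, qe⟩, qcap⟩,
    qAhi⟩, qDlo⟩, qNlo⟩, qDlo0⟩, qNlo0⟩, qAlo⟩, qDhi⟩, qNhi⟩, qDhi0⟩, qNhi0⟩ := hchk
  obtain ⟨hΔlo, hΔhi⟩ := hΔ
  obtain ⟨halo, hahi⟩ := ha
  obtain ⟨hblo, hbhi⟩ := hb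
  obtain ⟨hclo, hchi⟩ := hc
  -- real casts of the rational facts
  have ra₁ : (0 : ℝ) < a₁ := by exact_mod_cast qa₁
  have rc₁ : (0 : ℝ) ≤ c₁ := by exact_mod_cast qc₁
  have rcb : (c₂ : ℝ) < b₁ := by exact_mod_cast qcb
  have rΔ₁ : (0 : ℝ) < Δ₁ := by exact_mod_cast qΔ₁
  have re₁ : (0 : ℝ) ≤ e₁ := by exact_mod_cast qe₁
  have re : (e₁ : ℝ) ≤ e₂ := by exact_mod_cast qe
  have rcap : (c₂ : ℝ) * e₂ < (a₁ : ℝ) ^ 2 := by exact_mod_cast qcap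
  have hc0 : 0 ≤ c := rc₁.trans hclo
  have hc₂0 : (0 : ℝ) ≤ c₂ := hc0.trans hchi
  have htpd : 0 < tpd := lt_of_lt_of_le ra₁ halo
  have hb₁0 : (0 : ℝ) ≤ b₁ := hc₂0.trans rcb.le
  have re₂ : (0 : ℝ) ≤ e₂ := re₁.trans re
  have hcap₁ : (c₂ : ℝ) * e₁ ≤ (a₁ : ℝ) ^ 2 := by nlinarith [mul_le_mul_of_nonneg_left re hc₂0]
  have hcap₂ : (c₂ : ℝ) * e₂ ≤ (a₁ : ℝ) ^ 2 := rcap.le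
  -- OUTER bound at e₁
  have hOutR : abFilling Δ tpd tpp c e₁ ≤ ((outerFlagged K xl Ahi Dlo Nlo).card : ℝ) / (K : ℝ) ^ 2 := by
    refine abFilling_le_card_outerFlagged hK hG ?_ ?_ ?_ qDlo0 qNlo0
    · -- cA Δ e₁ ≤ Ahi
      have h1 : (Δ + e₁) ^ 2 ≤ ((Δ₂ : ℝ) + e₁) ^ 2 :=
        pow_le_pow_left₀ (by linarith) (by linarith) 2
      have h2 : (e₁ : ℝ) * ((Δ₂ : ℝ) + e₁) ^ 2 ≤ Ahi := by exact_mod_cast qAhi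
      unfold cA
      nlinarith [mul_le_mul_of_nonneg_left h1 re₁]
    · have hD := (fsD_mem_Icc (Δ := Δ) (tpd := tpd) (c := c) (ε := (e₁ : ℝ)) ra₁.le rc₁ re₁ (by linarith)
        hcap₁ ⟨hΔlo, hΔhi⟩ ⟨halo, hahi⟩ ⟨hclo, hchi⟩ ⟨le_rfl, le_rfl⟩).1
      have h2 : (Dlo : ℝ) ≤ ((Δ₁ : ℝ) + e₁) * ((a₁ : ℝ) ^ 2 - c₂ * e₁) := by exact_mod_cast qDlo
      exact h2.trans hD
    · have hN := (fsN_mem_Icc (tpd := tpd) (tpp := tpp) (c := c) (ε := (e₁ : ℝ)) ra₁.le hb₁0 rc₁ re₁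
        hcap₁ ⟨halo, hahi⟩ ⟨hblo, hbhi⟩ ⟨hclo, hchi⟩ ⟨le_rfl, le_rfl⟩).1
      rw [min_self] at hN
      have h2 : (Nlo : ℝ) ≤ ((c₁ : ℝ) + b₁) * (2 * (a₁ : ℝ) ^ 2 + e₁ * (b₁ - c₂)) := by exact_mod_cast qNlo
      exact h2.trans hN
  -- INNER bound at e₂
  have hInR : ((innerFlagged K xh e₂ Alo Dhi Nhi Δ₁ (a₂ ^ 2) (b₂ ^ 2)).card : ℝ) / (K : ℝ) ^ 2
      ≤ abFilling Δ tpd tpp c e₂ := by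
    refine card_innerFlagged_le_abFilling hK hG ?_ ?_ ?_ qDhi0 qNhi0 hΔlo qΔ₁.le hc0 ?_ ?_ (qe₁.trans qe)
    · have h1 : ((Δ₁ : ℝ) + e₂) ^ 2 ≤ (Δ + e₂) ^ 2 :=
        pow_le_pow_left₀ (by linarith) (by linarith) 2
      have h2 : (Alo : ℝ) ≤ (e₂ : ℝ) * ((Δ₁ : ℝ) + e₂) ^ 2 := by exact_mod_cast qAlo
      unfold cA
      nlinarith [mul_le_mul_of_nonneg_left h1 re₂]
    · have hD := (fsD_mem_Icc (Δ := Δ) (tpd := tpd) (c := c) (ε := (e₂ : ℝ)) ra₁.le rc₁ re₂ (by linarith)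
        hcap₂ ⟨hΔlo, hΔhi⟩ ⟨halo, hahi⟩ ⟨hclo, hchi⟩ ⟨le_rfl, le_rfl⟩).2
      have h2 : ((Δ₂ : ℝ) + e₂) * ((a₂ : ℝ) ^ 2 - c₁ * e₂) ≤ Dhi := by exact_mod_cast qDhi
      exact hD.trans h2
    · have hN := (fsN_mem_Icc (tpd := tpd) (tpp := tpp) (c := c) (ε := (e₂ : ℝ)) ra₁.le hb₁0 rc₁ re₂
        hcap₂ ⟨halo, hahi⟩ ⟨hblo, hbhi⟩ ⟨hclo, hchi⟩ ⟨le_rfl, le_rfl⟩).2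
      rw [max_self] at hN
      have h2 : ((c₂ : ℝ) + b₂) * (2 * (a₂ : ℝ) ^ 2 + e₂ * (b₂ - c₁)) ≤ Nhi := by exact_mod_cast qNhi
      exact hN.trans h2
    · push_cast; exact pow_le_pow_left₀ htpd.le hahi 2
    · push_cast; exact pow_le_pow_left₀ (hb₁0.trans hblo) hbhi 2
  -- the bracket
  have hOut' : ((outerFlagged K xl Ahi Dlo Nlo).card : ℝ) / (K : ℝ) ^ 2 < ν₁ := by
    have := (Rat.cast_lt (K := ℝ)).2 hOut
    push_cast at this
    exact this
  have hIn' : (ν₂ : ℝ) < ((innerFlagged K xh e₂ Alo Dhi Nhi Δ₁ (a₂ ^ 2) (b₂ ^ 2)).card : ℝ) / (K : ℝ) ^ 2 := by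
    have := (Rat.cast_lt (K := ℝ)).2 hIn
    push_cast at this
    exact this
  have hε : ε ∈ Set.Icc (e₁ : ℝ) e₂ := fermiEnergy_mem_Icc_of_abFilling_mem hOutR hOut' hInR hIn' hν
  refine ⟨hε, ?_⟩
  -- corners + ratio checks
  have hε0 : 0 ≤ ε := re₁.trans hε.1
  have hcb := fsRatio_corner_boundsB ra₁ rc₁ rcb hε0 (by linarith [hε.1])
    (by nlinarith [hε.2, mul_le_mul_of_nonneg_left hε.2 hc₂0])
    ⟨hΔlo, hΔhi⟩ ⟨halo, hahi⟩ ⟨hblo, hbhi⟩ ⟨hclo, hchi⟩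
  have hlo := (fsRatio_mem_of_ratioCheck hRlo hε).1
  have hhi := (fsRatio_mem_of_ratioCheck hRhi hε).2
  exact ⟨hlo.trans hcb.1, hcb.2.trans hhi⟩

end Summit.Ventures.CertifiedManyBodySolver.Downfold.Emery
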